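import Literature.NumberTheory.Transcendental.KZLogCalculusProofs

/-!
# OffTetraSectorKernel (stmt-KontsevichZagierPeriods-10557), line odd-hyperbolic-ladder: stub stub_conjCarriers

Sign bookkeeping for complex conjugation (rule (1b) of the Kontsevich–Zagier calculus).
For `z = a + i b` put `g_z(s) = b / ((1 − s a)² + (s b)²) = Im (z / (1 − s z))`; the band carrier is
`Band₁(z) = [{0 < s < 1, 1 ≤ u ≤ 1/s}, g_z(s)/u]` and the arc carrier is `C(z) = [(0,1), g_z]`.
For the conjugate `z' = z̄` (`Re z' = Re z`, `Im z' = −Im z`) one has `g_{z'} = −g_z` identically,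
so on the common domains the integrands of `Band₁(z̄)`, `C(z̄)` are the negatives of those of
`Band₁(z)`, `C(z)`, and `[Band₁(z)] + [Band₁(z̄)]`, `[C(z)] + [C(z̄)]` are relations by the congruence
lemma `KZ.of_add_of_mem_relations_of_eqOn_neg` (integrand additivity with the negated representation).

References: M. Kontsevich, D. Zagier, *Periods* (2001), §1.2, rule (1).
-/

noncomputable section

open Set MeasureTheory
open Literature.NumberTheory.Transcendental

namespace Summit.KontsevichZagierPeriods.HyperbolicBloch.OffTetraSectorKernel

/-- The pointwise sign identity behind conjugation of the carriers: with `a' = a`, `b' = −b`,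
`b' / ((1 − s a')² + (s b')²) = −(b / ((1 − s a)² + (s b)²))`. [cite: KontsevichZagier2001, §1.2] -/
theorem conjCarriers_kernel_neg {a b a' b' : ℝ} (hre : a' = a) (him : b' = -b) (s : ℝ) :
    b' / ((1 - s * a') ^ 2 + (s * b') ^ 2) = -(b / ((1 - s * a) ^ 2 + (s * b) ^ 2)) := by
  rw [hre, him, mul_neg, neg_sq, neg_div]

/-- STUB `stub_conjCarriers` (rule (1b), sign bookkeeping): complex conjugation negates the band and
arc carriers — for `z' = z̄` the integrands `g_{z'} = −g_z` on the common domains, so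
`[Band₁(z)] + [Band₁(z̄)]` and `[C(z)] + [C(z̄)]` are relations
(`KZ.of_add_of_mem_relations_of_eqOn_neg`). [cite: KontsevichZagier2001, §1.2 rule (1)] -/
theorem stub_conjCarriers :
    ∀ (z z' : ℂ), z'.re = z.re → z'.im = -z.im → ∀ (B B' : KZ.IntegralRep 2) (C C' : KZ.IntegralRep 1),
      B.domain = {w | (0 < w 0 ∧ w 0 < 1) ∧ 1 ≤ w 1 ∧ w 1 ≤ 1 / w 0} →
      Set.EqOn B.integrand (fun w => z.im / ((1 - w 0 * z.re) ^ 2 + (w 0 * z.im) ^ 2) / w 1) B.domain →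
      B'.domain = {w | (0 < w 0 ∧ w 0 < 1) ∧ 1 ≤ w 1 ∧ w 1 ≤ 1 / w 0} →
      Set.EqOn B'.integrand (fun w => z'.im / ((1 - w 0 * z'.re) ^ 2 + (w 0 * z'.im) ^ 2) / w 1) B'.domain →
      C.domain = {t | 0 < t 0 ∧ t 0 < 1} →
      Set.EqOn C.integrand (fun t => z.im / ((1 - t 0 * z.re) ^ 2 + (t 0 * z.im) ^ 2)) C.domain →
      C'.domain = {t | 0 < t 0 ∧ t 0 < 1} →
      Set.EqOn C'.integrand (fun t => z'.im / ((1 - t 0 * z'.re) ^ 2 + (t 0 * z'.im) ^ 2)) C'.domain →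
      KZ.of B + KZ.of B' ∈ KZ.relations ∧ KZ.of C + KZ.of C' ∈ KZ.relations := by
  intro z z' hre him B B' C C' hBd hBi hB'd hB'i hCd hCi hC'd hC'i
  have hBB' : B'.domain = B.domain := hB'd.trans hBd.symm
  have hCC' : C'.domain = C.domain := hC'd.trans hCd.symm
  refine ⟨KZ.of_add_of_mem_relations_of_eqOn_neg hBB' fun w hw => ?_,
    KZ.of_add_of_mem_relations_of_eqOn_neg hCC' fun t ht => ?_⟩
  · have hw' : w ∈ B'.domain := by rw [hBB']; exact hw
    rw [Pi.neg_apply, hB'i hw', hBi hw]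
    show z'.im / ((1 - w 0 * z'.re) ^ 2 + (w 0 * z'.im) ^ 2) / w 1 =
      -(z.im / ((1 - w 0 * z.re) ^ 2 + (w 0 * z.im) ^ 2) / w 1)
    rw [conjCarriers_kernel_neg hre him (w 0), neg_div]
  · have ht' : t ∈ C'.domain := by rw [hCC']; exact ht
    rw [Pi.neg_apply, hC'i ht', hCi ht]
    exact conjCarriers_kernel_neg hre him (t 0)

end Summit.KontsevichZagierPeriods.HyperbolicBloch.OffTetraSectorKernel

end
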